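import Literature.AlgebraicGeometry.Hironaka2017.S14LocalGlobal.R080Thm141
import Literature.AlgebraicGeometry.Hironaka2017.S11CoordFree.R073LeChain
import Literature.AlgebraicGeometry.Hironaka2017.S02Preliminaries.R001IdealExponents
import Summits.ResolutionOfSingularities.ResolutionOfSingularities.Theorems.MarkedTransferCampaignG1PnegaInterfaceV3
import Literature.AlgebraicGeometry.Hironaka2017.S11CoordFree.R075bProp117Inst
import Literature.AlgebraicGeometry.Hironaka2017.S14LocalGlobal.R086aEllBound
import HarnessLib

/-!
# [OURS · L1 G1 ℘nega-INTERFACE] Obligation **F3.2** — «Th 14.1 proof p.68 L19–L20: the Λ of Eq.(94) applied along the GLUED chain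
# (104) keeps the members inside ℘̃(Ě)» — over the checklist of record `Campaign.PnegaInterfaceV3` (p487629). Data-level kernel by
# res-type-086 (res-D-plan-1 ROUTING #8 (f) 2026-08-27T02:04:02Z; draft rev 2 `D/res-type-086/PnegaObligationF32.draft.lean` sha16
# fb4889f7c452cdd1, farm-clean), carried summit-side by the typer of record res-L1-type-o2: guard clauses ↦ the tree's
# `Campaign.IsCharFiltration K P`, + §3 `PnegaInterfaceV3.F32`; Lean terms otherwise byte-identical to the draft. res-D-plan-1 V3 RULING
# 01:55:32Z C1 («F3.2 Th 14.1 proof p.68 L19–L20 (sources in 𝔏₀(∞) ∩ ℘posi) = SEPARATE named obligation def over the structure»).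

HONEST FRAMING. Nothing here is a statement of H. Hironaka's manuscript *Resolution of singularities in positive characteristics*
(2017-03-23, [Hironaka2017], lit key `paper:url-3343fd9e678b`): Th 14.1's proof sentence is a CANDIDATE [claim: Hironaka2017,
status: under-review] and enters only as the SHAPE of an obligation; every `def` is OURS, asserted of no candidate; the theorems are
bookkeeping about typed statements. AI typing / AI kernel work, weaker than expert review; nothing here is progress on resolution of
singularities in positive characteristic; no claim beyond the kernel.

## The printed sentence and why it is an F3 CROSSING instance (res-adj-1 C1, PNEGA-INTERFACE v0.4)
p.68 L17–L20 (layout `lit/layout/p0068.txt`): «Proof. Note that the sequence Eq.(104) start with 𝔏(Ě) which is contained in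
(ρ^e(cot(Ě)) + I(Sing)^{p^e+1}Bl(ě, p^e+1)) ∩ (℘̃(Ě)). The Λ of Eq.(94) is operations of differentiation-procucts [sic] which
maps ℘̃(Ě) into itself because it is Diff-closed and algebra property.» In the typed chain (row 073 `S11CoordFree.Lambda`,
`diffImage`, `diffShift`; Def. 11.3 `leChain`): `Λ X = X ⊔ (Diff*_{Z/Z(p^i)} X)·(Diff_Z X)` where an operator `D` of order
`≤ μ` sends `a·T^k ↦ D(a)·T^{k−μ}` for EVERY `μ` with `D ∈ Diff^{≤μ}` (Def. 5.1's convention «order ≤ μ used in degree μ»).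
The chain STARTS in the positive degree `p^e` (`𝔏_e(0) = 𝔏(Ě,p^e)·T^{p^e} ⊂ ℘posi`, p.68 L17–L18) and `Λ` moves mass to
degrees `k − μ ≤ 0`: this is Diff-stability FROM NON-NEGATIVE SOURCE DEGREES, which the V3 structure deliberately does NOT
carry (`diff_mem_neg` = negative sources only; the guard's Th-4.1 clause = positive source AND positive target; blanket
non-negative-source Diff-stability + F2 is the collapse engine E-B of res-adj-1 CHECK 01:41:03Z). Hence an OBLIGATION,
scored per candidate, restricted to what Th. 14.1 (1) actually consumes: the members of THE chain (104) — i.e. AFTER each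
`τ`-intersection of Eq.(95) and each step-down `σ` — must stay inside the Bl(Z)-placement of the candidate.

## Distinction from F3.4 (res-type-072, ROUTING #8 (c2)) — recorded for res-adj-1
F3.4 = Rem. 11.4 p.63 L31–L33 = the BLANKET absorption «X ⊂ ℘̃ ⇒ (Diff*X)(Diff X) ⊂ ℘̃» for EVERY sub-object `X`
(binder `habs` of `S11CoordFree.Rem11_4_of_absorbs`), which feeds Th. 14.1 (1) only through
`Prop11_7_1_of_Rem11_4 → Thm14_1_1_leChain_of`. F3.2 below is the CHAIN-RESTRICTED (post-`τ`) demand = exactly the shape of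
row 075's `S11CoordFree.Prop11_7_1` («Assume 𝔏_{e−i}(0) ⊂ ℘̃(Ě) then 𝔏_{e−i}(j) ⊂ ℘̃(Ě) for all j», members of the chain
only) and of row 080's `S14LocalGlobal.Thm14_1_1` itself; it is implied by F3.4 + `τ Y ≤ Y` + `σ X ≤ X` and is strictly
weaker. [v2 NOTE — SUPERSEDED AS TYPED (OURS-DESK #90, lanes A/B PARTIAL): `F32` lets `tau`/`down` range over ALL contracting maps incl. `id`, so `F32 ⟺ Λ-orbit stability from every positive-support start` (`PnegaObligation.F32_iff_lambdaOrbit`, p494484) and F3.2 AS TYPED is ✗ for every V3 inhabitant over a field of characteristic `p` (`PnegaInterfaceV3.not_F32_of_charP`, p494484); the Eq. (95) / Def. 12.5 chain-(104)-OF-RECORD restriction described here is `F32tau` (§4, v2).] MECHANISM NOTE (res-type-086's hand computation, NOT kernel-checked, not a verdict — for whoever scores F3.4): at a chart with an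
LL-head `g = y^{p^e} + ε ∈ 𝔏(Ě)` whose remainder has a UNIT Hasse coefficient `u := ∂^{(j)}ε`, `p ∤ j = ord ε` (e.g.
`ord ε = p^e + 1`), take `X = ρ^ℓ(O)·g·T^{p^e} ⊂ ℘posi`, `D₁ = ∂^{(j)} ∈ Diff*_{Z/Z(p^i)}` (`i ≥ 1`: it kills `p^i`-th powers
since `p^i ∤ j`; and `D₁(y^{p^e}) = 0`), `D₂ = id ∈ Diff_Z`: the typed `Λ`-product contains `u·g·T^{d}` for EVERY
`d ≤ p^e − 1` (unbounded down-shift), so blanket absorption puts `u·g` into `tilde P (−a)` for all `a`; then V3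
`diff_mem_neg` with `∂^{(p^e)}` gives `∂^{(p^e)}(u g) ≡ u·(unit) (mod 𝔪)` — a UNIT in `tilde P (−a−p^e)`, against F7b-unit
at a (37)-placement. The chain form F3.2 is NOT hit by this mechanism: `τ_e` of Eq.(95) intersects with
`ρ^e(cot) + I(Sing)^{(p^e+1)}Bl(Z)` and removes `u·g·T^{d}` (`ord_ξ(u g) = p^e`). So F3.4-as-blanket looks jointly
unsatisfiable with F3⁻ ∧ F7b wherever such a head exists, while F3.2 is the live demand [v2: read «F32tau», §4 — the typed `F32`
admits `τ = id` and IS hit: `not_F32_of_charP` p494484] — a READING/SCORING remark for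
res-adj-1 / res-type-072, to be confirmed or killed in the kernel by them (M-size port: a §6 `Eq55` model of res-type-040
or res-type-065's 𝔸² LL-chain world supplies `g`).

## What is defined (data level; no structure, no inhabitant of V3 assumed)
* the V3 guard is the tree's `Campaign.IsCharFiltration K P` (`…G1PnegaInterfaceV3.lean` p487629; the draft inlined its four clauses).
* `blPlacement N` — the Bl(Z)-placement of a degree-indexed family `N : ℤ → AddSubgroup O`: the `x ∈ O[T;T⁻¹]` all of whose
  coefficients `x_k` lie in `N k` (how a candidate `tilde P ·` sits inside `Bl(Z)`; for the printed ℘̃ this is row 008's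
  `pTildeBl`-type placement, for the §13 slot it is the ambient of `TSharp`/`TFlat`).
* `HasPosSupport X` — «sources in 𝔏₀(∞) ∩ ℘posi»: every member of `X` has zero coefficients in degrees `≤ 0` (the start
  `𝔏_e(0) = 𝔏(Ě,p^e)·T^{p^e}` has it).
* **`F32 K p tilde`** — THE OBLIGATION: for every `K`-algebra `O` of characteristic `p`, every guarded `P`, every depth `ℓ`
  and top exponent `e`, every pair of operator families AS ROW 072 READS THEM (`DiffZ` ⊆ operators of finite order =
  «Diff_Z, all differential operators», `U62_3`-ambient; `DiffStar k` ⊆ finite-order operators annihilating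
  `ρ^k(O) = frobeniusPowerSubring O p k` = «Diff*_{Z/Z(p^k)}», row 072 `diffStarFrob`), every CONTRACTING within-level
  factor `tau k Y ≤ Y` (Eq.(95) is an intersection: `Rem11_5_holds`) and step-down `down k X ≤ X` (Def. 12.5 `σ`:
  `sigmaAt_le`), and every start `init` with positive support lying inside the placement: ALL members
  `leChain init (fun k => tau k ∘ Lambda DiffZ (DiffStar k)) down k j`, `k ≤ e`, `j : ℕ∞`, lie (as sets) inside
  `blPlacement (tilde P ·)`. Index convention: `leChain` level `k` = printed `𝔏_{e−k}` (row 080: `L i j := leChain … (e−i) j`),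
  whose `Λ`/`τ` carry the printed subscript `i = e − k` and use `Diff*_{Z/Z(p^{e−i})} = Diff*_{Z/Z(p^k)}` (Eq.(94)) — so the
  annihilation exponent at level `k` is `k`; if the consumer's family is indexed otherwise, o2 re-indexes in the bridge.
* `thm14_1_1_of_F32` — the bridge to the consumer's CONCLUSION shape: `F32` gives row 080's `S14LocalGlobal.Thm14_1_1 e L M`
  for `L i j := (leChain … (e − i) j).toAddSubgroup` and ANY additive subgroup `M` of `Bl(Z)` whose carrier is the placement
  (for the typed consumers `M` is a `BlSub`, i.e. additionally `ρ^ℓ(O)`-stable — a property of the candidate's non-positive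
  pieces that V3 does not list; recorded, not demanded here).

## Consumer decl ↦ tree binder that F3.2 discharges (for o2's «F32 I.tilde → binder» lemmas)
* `S14LocalGlobal.Thm14_1_1_of` (Proofs/S14LocalGlobal/Thm14p1.lean, res-type-080) — binder `hThm12_7 : S12GLUED.Thm12_7 e L pTilde`
  (label P:Thm12_7) at `L :=` the (104) chain, `pTilde :=` placement: `Thm14_1_1 ≡ Thm12_7` (`Thm14_1_1_iff_Thm12_7`), so
  `thm14_1_1_of_F32` IS that binder. Same binder in `Thm14_1_ours_of` / `Thm14_1_of` (P:Thm12_7) and in res-type-082's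
  `Thm14_2_eq108_sub_R2_of_tauTail` / `Thm14_1_2_leChain_of(_Lem14_5)` (P:Thm12_7, §M rows 809/819/823/824).
* `S14LocalGlobal.Thm14_1_1_leChain_of` (Thm14p1.lean) — binders `hProp11_7_1 : ∀ i ≤ e, S11CoordFree.Prop11_7_1 Lambda tau
  pTilde i (levelStart …)` (P:Prop11_7_1) [+ `hEq103_leChain`, P:Eq103_leChain, the positive start — F2/`pos_eq`, not F3]:
  F32's conclusion ranges over ALL levels `k ≤ e` and all `j` of the double induction from the TOP start (the lower level
  starts `levelStart …` are members of the same `leChain`), so it delivers the CONCLUSION of `Thm14_1_1_leChain_of` outright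
  (`thm14_1_1_of_F32`) and the binder `hProp11_7_1` is bypassed rather than instantiated (o2 may still derive the level-`i`
  instance of `Prop11_7_1` from F32 when the level start has positive support — only the top one does in general).
* res-type-001 `S14LocalGlobal.Thm14p1.deg_reading_mem_llHeadModuleAt_and_mem` (Thm14p1DegReading.lean p486075) and
  `Thm14_1_2_zeroTop_of_shapes` (Thm14p1ZeroTop.lean p486841) — binder `hx : x ∈ P (p^e)` («P:Th12.7-shape»: the degree-`p^e`
  coefficient of a member lies in `℘(Ě,p^e)`): F32 puts that coefficient in `tilde P (p^e)`, and V3 `pos_eq` (F2/O4) turns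
  it into `P (p^e)`.
* NOT discharged by F3.2 (by design): `habs` of `S11CoordFree.Rem11_4_of_absorbs` / `h114 : Rem11_4 …` of
  `Prop11_7_1_of_Rem11_4` (= F3.4, res-type-072); the `τ`-side binders R93.S1–S6 (HStep, TauTailInHeads_ours, InclB_ours …)
  of the (δ).1 kernels — they concern Eq.(95)/(96), not ℘̃.

## v2 (APPEND-ONLY) — the REPAIRED obligation `F32tau` («F32τ»), res-type-086 rev 2 (`D/res-type-086/PnegaObligationF32tau.draft.lean`
## sha16 bf3f6927bbea10b3, DELIVERED 2026-08-27T04:04:16Z), carried verbatim as §4 by res-L1-type-o2 g6; the #90 correction notes above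
WHY: lanes A/B PARTIAL on OURS-DESK #90 (res-ref-b11 03:15:41Z, res-ref-a4 03:20:53Z): `F32` quantifies `tau`/`down` over ALL contracting
maps, so `tau = down = id` is admissible and `F32 ⟺ Λ-orbit stability` (kernel `PnegaObligation.F32_iff_lambdaOrbit`, `…F32Kernel.lean`
p494484 §1); F3.2 AS TYPED is ✗ for every V3 inhabitant over a field of char `p` (`PnegaInterfaceV3.not_F32_of_charP`, p494484 §2). REPAIR
(res-D-plan-1 ruling 03:23:04Z (v), option (r1)): pin EVERYTHING the print names to the §§11–13 instance tuple OF RECORD at a §11 datum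
`D : S11CoordFree.CoordFreeDatum O p` (row 075b `R075bProp117Inst`): `Λ_{e−i} := S11CoordFree.LambdaOp K p ℓ i` (Eq. (94)), `τ_{e−i} :=
D.tauOp ℓ i` (Eq. (95), the `ρ^ℓ(O)`-span of `Y ⋂ ρ^i(ρ^{e−i}(cot(Ě)) + I(Sing)^{(p^{e−i}+1)}Bl(Z))`), `σ := S12GLUED.sigma (ρ^ℓ O) O p D.e`
(Def. 12.5 / (102)), start `𝔏_e(0) := leInit D.e (D.headsSub ℓ)` (Def. 11.3), chain (104) := `leChain …` — no abstract `tau/down/DiffZ/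
DiffStar/init` remains. §4 decls: `PnegaObligation.F32tauAt K p tilde P D ℓ` (AT a datum: start in the candidate's Bl(Z)-placement ⇒ every
member in it — exactly what Th. 12.7 p.66 L23–L24 / Th. 14.1 (1) p.68 L11 consume: `thm12_7_of_F32tauAt`, `thm14_1_1_of_F32tauAt`),
`F32tau K p tilde` (closed form: every `O`, guarded `P`, every datum `D` IN THE REGIME `D.singCl.Nonempty` — p.61 L30, p.62 L4–L5 —, every
`ℓ`), `F32tauGg` (under row 086's `ForLargeEll`, Rem. 11.1 «ℓ ≫ e») + `F32tauGg_of_F32tau`, and `PnegaInterfaceV3.F32tau` + `F32tau_iff`.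
RESIDUAL GENERALITY stated openly: `cot(Ě)(V)`, `𝔏(Ě,ℓ)(V)` unconstrained beyond their types; `F32 → F32tau` (the repair is a WEAKENING;
kernel `F32tau_of_F32` to follow in `…F32Kernel.lean` v2 by res-type-086). Cell F3.2 := `F32tau` (per-datum `F32tauAt`) for the scorers.
-/

noncomputable section

set_option linter.dupNamespace false -- mandated namespace of this single-conjunct summit

open LaurentPolynomial

namespace Summit.ResolutionOfSingularities.ResolutionOfSingularities.Theorems.Campaign

open Literature.AlgebraicGeometry.Resolution
open Literature.AlgebraicGeometry.Hironaka2017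
open Literature.AlgebraicGeometry.Hironaka2017.S02Preliminaries (frobeniusPowerSubring)
open Literature.AlgebraicGeometry.Hironaka2017.S11CoordFree (BlSub Lambda leChain)
open Literature.AlgebraicGeometry.Hironaka2017.S14LocalGlobal (Thm14_1_1)

universe u v

namespace PnegaObligation

variable {O : Type v} [CommRing O]

/-- [OURS · L1 G1 · F3.2] The Bl(Z)-PLACEMENT of a degree-indexed family of additive subgroups `N k ⊆ O = Bl(Z,k)`
(Def. 2.2 p.5: `Bl(Z) = ⊕_k Bl(Z,k)`, `Bl(Z,k) = O`, typed `O[T;T⁻¹]`): the elements of `Bl(Z)` all of whose coefficients lie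
in the corresponding piece. [folklore] -/
def blPlacement (N : ℤ → AddSubgroup O) : AddSubgroup O[T;T⁻¹] where
  carrier := {x | ∀ k : ℤ, x.coeff k ∈ N k}
  zero_mem' := fun k => by simp
  add_mem' := fun {x y} hx hy k => by
    simp only [Set.mem_setOf_eq] at hx hy ⊢
    rw [show (x + y).coeff k = x.coeff k + y.coeff k from Finsupp.add_apply _ _ _]
    exact add_mem (hx k) (hy k)
  neg_mem' := fun {x} hx k => by
    simp only [Set.mem_setOf_eq] at hx ⊢
    rw [show (-x).coeff k = -x.coeff k from Finsupp.neg_apply _ _]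
    exact neg_mem (hx k)

variable (p : ℕ) [Fact p.Prime] [CharP O p]

/-- [OURS · L1 G1 · F3.2] «sources in `𝔏₀(∞) ∩ ℘posi`» (res-adj-1 C1 wording for F3.2): a sub-object of `Bl(Z)` has
POSITIVE SUPPORT when every member has zero coefficients in all degrees `≤ 0` — as the start `𝔏_e(0) = 𝔏(Ě,p^e)·T^{p^e}`
of Def. 11.3 (p.63 L23) does. [folklore] -/
def HasPosSupport {ℓ : ℕ} (X : BlSub O p ℓ) : Prop :=
  ∀ x ∈ X, ∀ k : ℤ, k ≤ 0 → x.coeff k = 0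

end PnegaObligation

namespace PnegaObligation

/-- **[OURS · L1 G1 ℘nega-INTERFACE · obligation F3.2, DATA LEVEL — Th. 14.1 proof p.68 L19–L20]** replaces the role of «The Λ of Eq.(94) is operations of
differentiation-products which maps ℘̃(Ě) into itself because it is Diff-closed and algebra property», CONSUMED for the
members of the GLUED chain (104) only (Th. 14.1 (1) p.68 L11 / Prop. 11.7 (1) p.64 L17–L18 / Th. 12.7 p.66). Data-level over
the candidate `tilde` (V3 field type; base `K` a FIELD here because row 073's `Lambda` is typed over a field — V3's
`[CommRing K]` specialises), no structure assumed: for every `K`-algebra `O` of characteristic `p`, every guarded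
characteristic filtration `P` (`Campaign.IsCharFiltration K P`), every depth `ℓ` and top exponent `e`, every operator
families as row 072 reads Eq.(94) — `DiffZ` («Diff_Z»: operators of finite order), `DiffStar k` («Diff*_{Z/Z(p^k)}»:
finite-order operators annihilating `ρ^k(O)`; the `leChain` level `k` is the printed `𝔏_{e−k}`, whose `Λ_{e−k}` uses
`Diff*_{Z/Z(p^k)}`), every contracting within-level factor `tau` (Eq.(95) `τ`, an intersection) and step-down `down`
(Def. 12.5 `σ`), and every start `init` with positive support inside the placement of `tilde P ·` (p.68 L17–L18: the chain
starts at `𝔏(Ě) ⊂ ℘posi ∩ ℘̃`): every member `leChain init (τ∘Λ) down k j` (`k ≤ e`, `j : ℕ∞`, row 073's double induction)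
lies inside the Bl(Z)-placement of the candidate. Scored per candidate (N/A until then); strictly weaker than the blanket
F3.4 (Rem. 11.4). [v2 NOTE — SUPERSEDED AS TYPED (OURS-DESK #90): `tau`/`down` admit `id`, so `F32 ⟺ Λ-orbit stability` (`F32_iff_lambdaOrbit`) and is ✗ for every V3 inhabitant in char `p` (`PnegaInterfaceV3.not_F32_of_charP`, p494484); the chain-of-record repair is `F32tau` / `PnegaInterfaceV3.F32tau` (§4, v2).] [folklore] -/
def F32 (K : Type u) [Field K] (p : ℕ) [Fact p.Prime]
    (tilde : ∀ {B : Type v} [CommRing B] [Algebra K B], (ℕ → Ideal B) → ℤ → AddSubgroup B) : Prop :=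
  ∀ {O : Type v} [CommRing O] [Algebra K O] [CharP O p] (P : ℕ → Ideal O),
    IsCharFiltration K P →
    ∀ (ℓ e : ℕ) (DiffZ : Set (O →ₗ[K] O)) (DiffStar : ℕ → Set (O →ₗ[K] O)),
      (∀ D ∈ DiffZ, ∃ n : ℕ, IsDiffOpLE K n D) →
      (∀ (k : ℕ), ∀ D ∈ DiffStar k, (∃ n : ℕ, IsDiffOpLE K n D) ∧ ∀ c ∈ frobeniusPowerSubring O p k, D c = 0) →
    ∀ (tau : ℕ → BlSub O p ℓ → BlSub O p ℓ), (∀ (k : ℕ) (Y : BlSub O p ℓ), tau k Y ≤ Y) →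
    ∀ (down : ℕ → BlSub O p ℓ → BlSub O p ℓ), (∀ (k : ℕ) (X : BlSub O p ℓ), down k X ≤ X) →
    ∀ (init : BlSub O p ℓ), HasPosSupport p init →
      ((init : Set O[T;T⁻¹]) ⊆ blPlacement (fun k => tilde P k)) →
    ∀ (k : ℕ) (j : ℕ∞), k ≤ e →
      ((leChain init (fun k => tau k ∘ Lambda DiffZ (DiffStar k)) down k j : BlSub O p ℓ) : Set O[T;T⁻¹]) ⊆
        blPlacement (fun k => tilde P k)

/-- **Bridge to the consumer's conclusion shape (row 080 `S14LocalGlobal.Thm14_1_1`, p.68 L11 «Every 𝔏_i(j) of Eq.(104) is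
contained in ℘̃(Ě) for all (i, j)»).** If the candidate satisfies `F32`, then for every datum as in `F32` and every additive
subgroup `M` of `Bl(Z)` whose carrier is the placement of `tilde P ·` (for the typed consumers: the `BlSub` they call `℘̃(Ě)`),
`Thm14_1_1 e (fun i j => (leChain … (e − i) j).toAddSubgroup) M` holds — i.e. the binder `hThm12_7`/P:Thm12_7 of
`Thm14_1_1_of` (≡ `Thm14_1_1`, `Thm14_1_1_iff_Thm12_7`) at the chain of (104). [folklore] -/
theorem thm14_1_1_of_F32 {K : Type u} [Field K] {p : ℕ} [Fact p.Prime]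
    {tilde : ∀ {B : Type v} [CommRing B] [Algebra K B], (ℕ → Ideal B) → ℤ → AddSubgroup B}
    (hF : F32 K p tilde)
    {O : Type v} [CommRing O] [Algebra K O] [CharP O p] (P : ℕ → Ideal O)
    (hP : IsCharFiltration K P)
    (ℓ e : ℕ) (DiffZ : Set (O →ₗ[K] O)) (DiffStar : ℕ → Set (O →ₗ[K] O))
    (hZ : ∀ D ∈ DiffZ, ∃ n : ℕ, IsDiffOpLE K n D)
    (hS : ∀ (k : ℕ), ∀ D ∈ DiffStar k, (∃ n : ℕ, IsDiffOpLE K n D) ∧ ∀ c ∈ frobeniusPowerSubring O p k, D c = 0)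
    (tau : ℕ → BlSub O p ℓ → BlSub O p ℓ) (htau : ∀ (k : ℕ) (Y : BlSub O p ℓ), tau k Y ≤ Y)
    (down : ℕ → BlSub O p ℓ → BlSub O p ℓ) (hdown : ∀ (k : ℕ) (X : BlSub O p ℓ), down k X ≤ X)
    (init : BlSub O p ℓ) (hpos : HasPosSupport p init)
    (hinit : (init : Set O[T;T⁻¹]) ⊆ blPlacement (fun k => tilde P k))
    (M : AddSubgroup O[T;T⁻¹]) (hM : (M : Set O[T;T⁻¹]) = blPlacement (fun k => tilde P k)) :
    Thm14_1_1 e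
      (fun i j => (leChain init (fun k => tau k ∘ Lambda DiffZ (DiffStar k)) down (e - i) j).toAddSubgroup) M := by
  intro i _ j x hx
  have h := hF P hP ℓ e DiffZ DiffStar hZ hS tau htau down hdown init hpos hinit (e - i) j (Nat.sub_le e i) hx
  rw [← SetLike.mem_coe, hM]
  exact h

end PnegaObligation


/-! ## §3 Over the checklist of record: `PnegaInterfaceV3.F32` (typer res-L1-type-o2) -/

namespace PnegaInterfaceV3

variable {K : Type u} [Field K] {p : ℕ} [Fact p.Prime] {prov : PnegaProvenance.{u, v} K}

/-- [OURS · L1 G1 ℘nega-INTERFACE · obligation F3.2 over V3] replaces the role of Th 14.1's proof sentence p.68 L19–L20 («the Λ of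
Eq.(94) … maps ℘̃(Ě) into itself») RESTRICTED to what Th. 14.1 (1) consumes — the members of the glued chain (104), sources in
`𝔏₀(∞) ∩ ℘posi` — as a SCORED OBLIGATION on an inhabitant `I` of the checklist `PnegaInterfaceV3` over a FIELD `K` of
characteristic `p` (res-D-plan-1 V3 RULING 01:55:32Z C1): `PnegaObligation.F32 K p I.tilde`. Its bridge to the consumer binder
P:Thm12_7 / `S14LocalGlobal.Thm14_1_1` is `PnegaObligation.thm14_1_1_of_F32` at `I.tilde`. NOT a structure field, NOT a statement of
the manuscript, asserted of no candidate; strictly weaker than the blanket F3.4 (Rem 11.4, res-type-072). VACUITY: holds for the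
top candidate; for the diagnostic «⊥-bypass» it demands that the chain never reaches a degree `≤ 0` with a non-zero coefficient —
a genuine demand. [v2 NOTE — SUPERSEDED AS TYPED (OURS-DESK #90): `tau`/`down` admit `id`, so `F32 ⟺ Λ-orbit stability` (`F32_iff_lambdaOrbit`) and is ✗ for every V3 inhabitant in char `p` (`PnegaInterfaceV3.not_F32_of_charP`, p494484); the chain-of-record repair is `F32tau` / `PnegaInterfaceV3.F32tau` (§4, v2).] [folklore] -/
def F32 (I : PnegaInterfaceV3 K p prov) : Prop :=
  PnegaObligation.F32 K p I.tilde

/-- Unfolding anchor (by `Iff.rfl`). [folklore] -/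
theorem F32_iff (I : PnegaInterfaceV3 K p prov) : I.F32 ↔ PnegaObligation.F32 K p I.tilde :=
  Iff.rfl

end PnegaInterfaceV3

end Summit.ResolutionOfSingularities.ResolutionOfSingularities.Theorems.Campaign

end

/-! ## §4 (v2, APPEND-ONLY) The REPAIRED obligation `F32tau` («F32τ») — res-type-086 rev 2 bf3f6927bbea10b3, Lean terms verbatim -/

noncomputable section

set_option linter.dupNamespace false -- mandated namespace of this single-conjunct summit

open LaurentPolynomial

namespace Summit.ResolutionOfSingularities.ResolutionOfSingularities.Theorems.Campaign

open Literature.AlgebraicGeometry.Resolution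
open Literature.AlgebraicGeometry.Hironaka2017
open Literature.AlgebraicGeometry.Hironaka2017.S11CoordFree (BlSub Lambda leChain leInit LambdaOp CoordFreeDatum)
open Literature.AlgebraicGeometry.Hironaka2017.S12GLUED (sigma Thm12_7)
open Literature.AlgebraicGeometry.Hironaka2017.S14LocalGlobal (Thm14_1_1 ForLargeEll)

universe u v

namespace PnegaObligation

/-! ## The repaired obligation `F32tau` («F32τ»): the chain (104) OF RECORD at a §11 datum -/

/-- **[OURS · ℘nega-INTERFACE obligation F3.2, repaired, AT A DATUM — Th. 14.1 proof p.68 L17–L24 / Th. 12.7 p.66 L19–L24]**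
replaces the role of «the sequence Eq.(104) start with 𝔏(Ě) which is contained in (…) ∩ (℘̃(Ě)). The Λ of Eq.(94) … maps
℘̃(Ě) into itself … the factor τ of Eq,(95) of τΛ denoted by ↣ is acting as replacement by a subset … The same is true for ∇
denoted by ↘» RESTRICTED to the members of THE chain (104), for a candidate `tilde` in place of `℘̃(Ě)`. Data: a `K`-algebra
`O` of characteristic `p` (sections over the chosen affine `V`, p.61 L30), `P` (for `℘(Ě,·)(V)`), a §11 datum
`D : CoordFreeDatum O p` (row 071: `Sing(Ě)_cl ∩ V`, `cot(Ě)(V)`, `𝔏(Ě,ℓ)(V)`, `e` with `q = p^e`, …) and a depth `ℓ`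
(Rem. 11.1). Statement: IF the start `𝔏_e(0) = 𝔏(Ě,p^e)(V)·T^{p^e}` (`leInit D.e (D.headsSub ℓ)`, Def. 11.3 p.63 L23) lies in
the Bl(Z)-placement of `tilde P ·` (candidate-side Eq. (103) p.66 L20, = binder `h103` of `S12GLUED.Thm12_7_inst_of_Rem11_4`),
THEN every `𝔏_{e−i}(j)` (`i ≤ e`, `j ∈ ℕ ∪ {∞}`) of row 073's `leChain` built with `τ_{e−i} ∘ Λ_{e−i}` :=
`D.tauOp ℓ i ∘ LambdaOp K p ℓ i` (Eq. (94)/(95)/(97) at rows 072/074's typed `Diff_Z`, `Diff*_{Z/Z(p^i)}`, `cot(Ě)·T`,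
`I(Sing)^{(m)}Bl(Z)` — row 075b) and the step-downs `σ` := `S12GLUED.sigma (ρ^ℓ O) O p D.e` (Def. 12.5 pinned to `θ`, row 078b)
lies, as a set, in that placement. No abstract operator remains. Asserted of no candidate; N/A until scored. VACUITY: holds
for the `⊤` candidate; holds vacuously at pairs `(P, D)` violating the start condition. [folklore] -/
def F32tauAt (K : Type u) [Field K] (p : ℕ) [Fact p.Prime]
    (tilde : ∀ {B : Type v} [CommRing B] [Algebra K B], (ℕ → Ideal B) → ℤ → AddSubgroup B)
    {O : Type v} [CommRing O] [Algebra K O] [CharP O p] (P : ℕ → Ideal O) (D : CoordFreeDatum O p) (ℓ : ℕ) :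
    Prop :=
  ((leInit D.e (D.headsSub ℓ) : BlSub O p ℓ) : Set O[T;T⁻¹]) ⊆ blPlacement (fun k => tilde P k) →
    ∀ (i : ℕ) (j : ℕ∞), i ≤ D.e →
      ((leChain (leInit D.e (D.headsSub ℓ)) (fun i => D.tauOp ℓ i ∘ LambdaOp K p ℓ i)
          (sigma (iterateFrobenius O p ℓ).range O p D.e) i j : BlSub O p ℓ) : Set O[T;T⁻¹]) ⊆
        blPlacement (fun k => tilde P k)

/-- **[OURS · ℘nega-INTERFACE obligation F3.2, repaired — the SCORED closed form `F32tau` («F32τ»)]** replaces the role of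
Th. 14.1's proof sentence p.68 L19–L23 along the GLUED chain (104) (Rem. 13.1 p.67 L11–L12 «all the ↣ are the applications of
τΛ in the sense of Eq.(94) and Eq.(95), while the ↘ are σ of Def.(12.5)»): for every `K`-algebra `O` of characteristic `p`,
every guarded characteristic filtration `P` (`IsCharFiltration K P`, V3 guard C2), every §11 datum `D : CoordFreeDatum O p`
(row 071) in the regime `Sing(Ě)_cl ∩ V ≠ ∅` (`D.singCl.Nonempty`; p.61 L30 «an open affine V ∩ Sing(Ě)_cl», p.62 L4–L5) and
every depth `ℓ`, `F32tauAt K p tilde P D ℓ`. The instance of record for a concrete `Ě` is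
`D := CoordFreeDatum.ofCarriers p f Ě V e he m` (row 071 file b). Implied by the landed `F32` (kernel `F32tau_of_F32`,
`…F32Kernel.lean` v2) and by F3.4 at the datum. Asserted of no candidate. [folklore] -/
def F32tau (K : Type u) [Field K] (p : ℕ) [Fact p.Prime]
    (tilde : ∀ {B : Type v} [CommRing B] [Algebra K B], (ℕ → Ideal B) → ℤ → AddSubgroup B) : Prop :=
  ∀ {O : Type v} [CommRing O] [Algebra K O] [CharP O p] (P : ℕ → Ideal O),
    IsCharFiltration K P → ∀ (D : CoordFreeDatum O p), D.singCl.Nonempty → ∀ ℓ : ℕ, F32tauAt K p tilde P D ℓ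

/-- **[OURS · F3.2 repaired under Rem. 11.1's scope rule «ℓ ≫ e»]** (p.63 L7–L14 «We will be choosing a sufficiently large
integer ℓ ≫ e … Important point is only that ℓ is big enough»; p.68 L9–L10 «𝔏(Ě) is viewed as ρ^ℓ(O_ξ)-module with a chosen and
fixed ℓ ≫ e»): the same closed form with the depth quantified «for all sufficiently large ℓ» (row 086 `S14LocalGlobal.ForLargeEll`
= `∀ᶠ ℓ in Filter.atTop`) per datum, instead of «for every ℓ». Offered for the scorer's choice (res-adj-1); `F32tau` implies it
(`F32tauGg_of_F32tau`). Asserted of no candidate. [folklore] -/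
def F32tauGg (K : Type u) [Field K] (p : ℕ) [Fact p.Prime]
    (tilde : ∀ {B : Type v} [CommRing B] [Algebra K B], (ℕ → Ideal B) → ℤ → AddSubgroup B) : Prop :=
  ∀ {O : Type v} [CommRing O] [Algebra K O] [CharP O p] (P : ℕ → Ideal O),
    IsCharFiltration K P → ∀ D : CoordFreeDatum O p, D.singCl.Nonempty →
      ForLargeEll fun ℓ => F32tauAt K p tilde P D ℓ

/-- `F32tau → F32tauGg` («for every ℓ» implies «for all large ℓ»). [folklore] -/
theorem F32tauGg_of_F32tau {K : Type u} [Field K] {p : ℕ} [Fact p.Prime]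
    {tilde : ∀ {B : Type v} [CommRing B] [Algebra K B], (ℕ → Ideal B) → ℤ → AddSubgroup B}
    (h : F32tau K p tilde) : F32tauGg K p tilde :=
  fun P hP D hD => Filter.Eventually.of_forall fun ℓ => h P hP D hD ℓ

section Bridges

variable {K : Type u} [Field K] {p : ℕ} [Fact p.Prime]
  {tilde : ∀ {B : Type v} [CommRing B] [Algebra K B], (ℕ → Ideal B) → ℤ → AddSubgroup B}
  {O : Type v} [CommRing O] [Algebra K O] [CharP O p] {P : ℕ → Ideal O} {D : CoordFreeDatum O p} {ℓ : ℕ}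

/-- **Bridge to Th. 12.7 at the instance tuple of record** (p.66 L23–L24 «𝔏_{e−i}(j) ⊂ ℘̃(Ě) for all (i, j)»; consumer
`S12GLUED.Thm12_7_inst_of_Rem11_4`, Proofs/S12GLUED/Thm127d.lean, whose binder `hRem11_4` = F3.4 at the datum is BYPASSED):
from `F32tauAt` and the candidate-side (103) `h103`, row 079's `Thm12_7 D.e (leChain 𝔏_e(0) (τ∘Λ) σ) M` for every
`ρ^ℓ(O)`-submodule `M` of `Bl(Z)` whose carrier is the placement of `tilde P ·` (the consumer's `D.ptildeBl ℓ` when the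
candidate is the datum's own `℘̃`). [folklore] -/
theorem thm12_7_of_F32tauAt (h : F32tauAt K p tilde P D ℓ)
    (h103 : ((leInit D.e (D.headsSub ℓ) : BlSub O p ℓ) : Set O[T;T⁻¹]) ⊆ blPlacement (fun k => tilde P k))
    (M : BlSub O p ℓ) (hM : (M : Set O[T;T⁻¹]) = blPlacement (fun k => tilde P k)) :
    Thm12_7 D.e
      (leChain (leInit D.e (D.headsSub ℓ)) (fun i => D.tauOp ℓ i ∘ LambdaOp K p ℓ i)
        (sigma (iterateFrobenius O p ℓ).range O p D.e)) M := by
  intro k hk j x hx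
  have hx' := h h103 k j hk hx
  rw [← SetLike.mem_coe, hM]
  exact hx'

/-- **Bridge to Th. 14.1 (1) in row 080's indexing** (p.68 L11 «Every 𝔏_i(j) of Eq.(104) is contained in ℘̃(Ě) for all
(i, j)»; `S14LocalGlobal.Thm14_1_1 e L M` with `L i j :=` the additive group of `leChain … (e − i) j`, the binder `hThm12_7` /
P:Thm12_7 of `Thm14_1_1_of`, Proofs/S14LocalGlobal/Thm14p1.lean): from `F32tauAt` and `h103`, for every additive subgroup `M`
of `Bl(Z)` whose carrier is the placement. [folklore] -/
theorem thm14_1_1_of_F32tauAt (h : F32tauAt K p tilde P D ℓ)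
    (h103 : ((leInit D.e (D.headsSub ℓ) : BlSub O p ℓ) : Set O[T;T⁻¹]) ⊆ blPlacement (fun k => tilde P k))
    (M : AddSubgroup O[T;T⁻¹]) (hM : (M : Set O[T;T⁻¹]) = blPlacement (fun k => tilde P k)) :
    Thm14_1_1 D.e
      (fun i j => (leChain (leInit D.e (D.headsSub ℓ)) (fun i => D.tauOp ℓ i ∘ LambdaOp K p ℓ i)
        (sigma (iterateFrobenius O p ℓ).range O p D.e) (D.e - i) j).toAddSubgroup) M := by
  intro i _ j x hx
  have hx' := h h103 (D.e - i) j (Nat.sub_le D.e i) hx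
  rw [← SetLike.mem_coe, hM]
  exact hx'

end Bridges

end PnegaObligation

/-! ## Over the checklist of record: `PnegaInterfaceV3.F32tau` -/

namespace PnegaInterfaceV3

variable {K : Type u} [Field K] {p : ℕ} [Fact p.Prime] {prov : PnegaProvenance.{u, v} K}

/-- [OURS · L1 G1 ℘nega-INTERFACE · obligation F3.2 REPAIRED over V3] the chain-of-record form of F3.2 for an inhabitant `I` of
the checklist `PnegaInterfaceV3` over a field `K` of characteristic `p`: `PnegaObligation.F32tau K p I.tilde` (every member of the
GLUED chain (104) built with rows 072–075b/078b's typed `Λ`, `τ`, `σ` from `𝔏(Ě,p^e)(V)·T^{p^e}` lies in the placement of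
`I.tilde P ·`, at every §11 datum with `Sing(Ě)_cl ∩ V ≠ ∅` whose start does). Replaces the role of Th. 14.1's proof sentence
p.68 L19–L23 restricted to the chain; NOT a structure field, NOT a statement of the manuscript, asserted of no candidate; implied
by `I.F32` (which is ✗ for every inhabitant, `not_F32_of_charP`). [folklore] -/
def F32tau (I : PnegaInterfaceV3 K p prov) : Prop :=
  PnegaObligation.F32tau K p I.tilde

/-- Unfolding anchor (by `Iff.rfl`). [folklore] -/
theorem F32tau_iff (I : PnegaInterfaceV3 K p prov) : I.F32tau ↔ PnegaObligation.F32tau K p I.tilde :=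
  Iff.rfl

end PnegaInterfaceV3

end Summit.ResolutionOfSingularities.ResolutionOfSingularities.Theorems.Campaign

end
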